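import Summits.QuantumFields.YangMills.Theorems.LuscherReductionTwistedTraceScalingValleyBOUpperPow
import HarnessLib

/-!
# The k = 0 FLOOR of the BO sub-target as an interface to lane B's vacuum estimate: `ValleyFloorAt ⇐ VacuumFloorAt + a normalisation comparison`
# (lane A of S-BASE, crux `TwistedTraceScaling` stmt-QuantumFields-20203; design note `pub/ym-fleet/ym-luscher-20007-p1/COARSE-DESIGN.md` §17.10)

After `…ValleyBOUpperPow` the valley side of COARSE-UPPER(L) is reduced to `ValleyFloorAt L (β^{−p}) (1/2) N_B`: a LOWER bound `λ₀(β,L) ≥ N_B(β)·e^{−6Z₀}·e^{−εβ^{−p}}`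
(all `ε > 0`, eventually).  The plain Riccati trial state cannot prove it (§17.10: its sub-solution defect at the vacuum tube is an `O(1)` factor); the estimate is lane B's
COARSE-LOWER core — an ADIABATIC trial state with `(H-SUB)+(MASS)` at `k = 0`.  This file types the hand-over:
* `VacuumFloorAt L Λ tol` — "eventually `Λ(β)·e^{−tol(β)} ≤ λ₀(β,L)`" (lane B's (H-SUB)+(MASS) at k = 0 with ITS normalisation `Λ` and tolerance `tol`);
* ★ `valleyFloorAt_of_vacuumFloor` — `VacuumFloorAt L Λ tol`, `tol = o(δ)` and the normalisation comparison `N(β)·e^{−6·toronZPE κ 0 0} ≤ Λ(β)·e^{o(δ)}` give `ValleyFloorAt L δ κ N`;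
* ★★★ `coarseNoIntruderAt_of_vacuumFloor_pow` — END TO END: COARSE-UPPER(L) ⇐ `VacuumFloorAt L Λ tol` + `tol = o(β^{−p})` + `N_B e^{−6Z₀(1/2)} ≤ Λ e^{o(β^{−p})}` + INNER one-orbit,
  for `0 < p < 1/3`, `4p < q < 8/9`, `0 < r < 1/2`, `0 < m`, `2r < q − m/2`.
HONEST FRAMING: a typed interface (bookkeeping) for a stub lane of a child of the CONDITIONAL reduction route (femto rung R2b1); `VacuumFloorAt` for lane B's `Λ_B` is OPEN
(lane B's (H-SUB)+(MASS)); not infinite volume, not a gap, not Clay.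
-/

set_option autoImplicit false

noncomputable section

open MeasureTheory Real
open scoped BigOperators
open Literature.MathematicalPhysics.QuantumFieldTheory
open Literature.MathematicalPhysics.QuantumLattice

namespace Summit.QuantumFields.YangMills.Theorems.FemtoTransferGap

open TwoLattice TwoLattice.Toron TwoLattice.Cov TwoLattice.Stiff TwoLattice.Harm

variable (L : ℕ) [NeZero L]

/-- **Lane B's vacuum floor, typed**: eventually in `β`, `Λ(β)·e^{−tol(β)} ≤ λ₀(β, L)` ((H-SUB)+(MASS) at `k = 0` for a physical trial state with normalisation `Λ`).
Target text of this programme (Lüscher 1983 §3), not a published theorem. -/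
def VacuumFloorAt (Λ tol : ℝ → ℝ) : Prop :=
  ∃ β0 : ℝ, ∀ β : ℝ, β0 ≤ β → Λ β * Real.exp (-tol β) ≤ levelValue su2Rep L β 0

variable {L}

/-- ★ **FLOOR from the vacuum floor + normalisation comparison**: if `Λ·e^{−tol} ≤ λ₀` eventually, `tol ≤ ε·δ` eventually for every `ε > 0`, and for every `ε > 0`
eventually `N(β)·e^{−6·toronZPE κ 0 0} ≤ Λ(β)·e^{ε·δ(β)}`, then `ValleyFloorAt L δ κ N`. [cite: Luscher1983, §3] -/
theorem valleyFloorAt_of_vacuumFloor {Λ tol δ N : ℝ → ℝ} {κ : ℝ} (hV : VacuumFloorAt L Λ tol) (hΛ : ∀ β, 0 ≤ Λ β)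
    (htol : ∀ ε : ℝ, 0 < ε → ∃ β0 : ℝ, ∀ β : ℝ, β0 ≤ β → tol β ≤ ε * δ β)
    (hcmp : ∀ ε : ℝ, 0 < ε → ∃ β0 : ℝ, ∀ β : ℝ, β0 ≤ β → N β * Real.exp (-(6 * toronZPE L κ 0 0)) ≤ Λ β * Real.exp (ε * δ β)) :
    ValleyFloorAt L δ κ N := by
  intro ε hε
  obtain ⟨βV, hβV⟩ := hV
  obtain ⟨βt, hβt⟩ := htol (ε / 2) (by positivity)
  obtain ⟨βc, hβc⟩ := hcmp (ε / 2) (by positivity)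
  refine ⟨max βV (max βt βc), fun β hβ => ?_⟩
  have h1 := hβV β ((le_max_left _ _).trans hβ)
  have h2 := hβt β (((le_max_left _ _).trans (le_max_right _ _)).trans hβ)
  have h3 := hβc β (((le_max_right _ _).trans (le_max_right _ _)).trans hβ)
  -- `N e^{−6Z₀} e^{−εδ} ≤ Λ e^{εδ/2} e^{−εδ} = Λ e^{−εδ/2} ≤ Λ e^{−tol} ≤ λ₀`
  have h4 : N β * Real.exp (-(6 * toronZPE L κ 0 0)) * Real.exp (-(ε * δ β)) ≤ Λ β * Real.exp (ε / 2 * δ β) * Real.exp (-(ε * δ β)) :=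
    mul_le_mul_of_nonneg_right h3 (Real.exp_pos _).le
  have h5 : Λ β * Real.exp (ε / 2 * δ β) * Real.exp (-(ε * δ β)) = Λ β * Real.exp (-(ε / 2 * δ β)) := by
    rw [mul_assoc, ← Real.exp_add]; congr 1; congr 1; ring
  have h6 : Λ β * Real.exp (-(ε / 2 * δ β)) ≤ Λ β * Real.exp (-tol β) :=
    mul_le_mul_of_nonneg_left (Real.exp_le_exp.2 (by linarith)) (hΛ β)
  linarith [h4, h5.le, h5.ge, h6, h1]

/-- ★★★ **END TO END FROM LANE B'S VACUUM FLOOR**: for `0 < p < 1/3`, `4p < q < 8/9`, `0 < r`, `2r < 1`, `0 < m`, `2r < q − m/2`, the vacuum floor `VacuumFloorAt L Λ tol`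
with `tol = o(β^{−p})`, the normalisation comparison `N_B(β)·e^{−6·toronZPE (1/2) 0 0} ≤ Λ(β)·e^{o(β^{−p})}` (`N_B β = riccatiN L β β^{−r} (2β^{−q}) β^{−m}`) and the one-orbit
INNER NO-INTRUDER give COARSE-UPPER(L). [cite: Luscher1983, §3] [cite: LuscherMunster1984, §2] -/
theorem coarseNoIntruderAt_of_vacuumFloor_pow {p q r m : ℝ} (hp0 : 0 < p) (hp : p < 1 / 3) (hpq : 4 * p < q) (hq : q < 8 / 9) (hr : 0 < r) (hr1 : 2 * r < 1)
    (hm : 0 < m) (hrq : 2 * r < q - m / 2) {Λ tol : ℝ → ℝ} (hV : VacuumFloorAt L Λ tol) (hΛ : ∀ β, 0 ≤ Λ β)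
    (htol : ∀ ε : ℝ, 0 < ε → ∃ β0 : ℝ, ∀ β : ℝ, β0 ≤ β → tol β ≤ ε * powScale p β)
    (hcmp : ∀ ε : ℝ, 0 < ε → ∃ β0 : ℝ, ∀ β : ℝ, β0 ≤ β →
      riccatiN L β (powScale r β) (2 * powScale q β) (powScale m β) * Real.exp (-(6 * toronZPE L (1 / 2) 0 0)) ≤ Λ β * Real.exp (ε * powScale p β))
    (hI : InnerNoIntruderOneOrbitAt L (powScale p)) :
    ∀ k : ℕ, ∀ d : ℝ, d < levelGap k → ∃ lam0 : ℝ, 0 < lam0 ∧ ∀ lam : ℝ, 0 < lam → lam ≤ lam0 →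
      ∀ β : ℝ, InFemtoWindow lam β L →
        levelValue su2Rep L β k ≤ Real.exp (-(d * luscherLambda β L) / L) * levelValue su2Rep L β 0 :=
  coarseNoIntruderAt_of_floor_pow hp0 hp hpq hq hr hr1 hm hrq (valleyFloorAt_of_vacuumFloor hV hΛ htol hcmp) hI

end Summit.QuantumFields.YangMills.Theorems.FemtoTransferGap

end
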